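import Summits.AtomisticToContinuum.BoseEinsteinCondensation.Theorems.LatticeODLROOffHalfFilling.Negative.SaturationNoLRO

/-!
# Crux `LatticeODLROOffHalfFilling` — lemmas for the boundary point `|μ| = 3`

Crux-disprover support for `stmt-AtomisticToContinuum-11033` (route BECGroundStateSOS), part 3a
(parts 1–2: `SaturationCertificate.lean`, `SaturationNoLRO.lean`; part 3b: `SaturationBoundary.lean`):

* `re_gsf_nonneg_of_groundSpace` — positivity transfer: a quadratic form `≥ 0` (real part) on the
  ground space of `A` has `Re ω_A ≥ 0` in the tracial ground state (`tr(P₀T) = Σ_σ⟨P₀e_σ, TP₀e_σ⟩`);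
* `E_mulVec_apply`, `E_mul_E`, `eq_smul_upVec_of_forall_E_mulVec_eq_zero` — the action of `S⁺_x`
  on configuration amplitudes, `(S⁺_x)² = 0`, and `⋂_y ker S⁺_y = ℂ|⇑⟩`;
* `E_mul_conjTranspose_sub`, `sum_hop_eq` — `[S⁺_x, S⁻_x] = 2S³_x` and the order-parameter operator
  `Σ_{x,y}(S¹_xS¹_y + S²_xS²_y) = (S⁺_tot)ᴴ S⁺_tot + S³_tot`;
* `re_totalSpin_two_quad_le` — `Re⟨v, S³_tot v⟩ ≤ (|Λ|/2)‖v‖²`.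
All [folklore].
-/

noncomputable section

namespace Summit.AtomisticToContinuum.BoseEinsteinCondensation.Theorems.LatticeODLROOffHalfFilling.Negative

open Literature.MathematicalPhysics.QuantumLattice Literature.Probability.LatticeModels Matrix Finset
open scoped ComplexOrder BigOperators

/-! ### The boundary point `|μ| = 3` (tightness): no ODLRO AT saturation either -/

section Boundary

/-- **Positivity transfer from the ground space to the tracial ground state**: if the quadratic
form of `T` is `≥ 0` (real part) on the ground space of `A`, then `Re ω_A(T) ≥ 0`
(`tr(P₀T) = tr(P₀TP₀) = Σ_σ ⟨P₀e_σ, T P₀e_σ⟩`). [folklore] -/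
theorem re_gsf_nonneg_of_groundSpace {m : Type*} [Fintype m] [DecidableEq m]
    {A T : Matrix m m ℂ} (hT : ∀ v ∈ A.groundSpace, 0 ≤ (star v ⬝ᵥ T *ᵥ v).re) :
    0 ≤ (A.groundStateFunctional T).re := by
  rw [groundStateFunctional_apply]
  set P := A.groundProj with hPdef
  have hP : Pᴴ = P := (groundProj_isHermitian A).eq
  have hPP : P * P = P := groundProj_mul_self A
  have h1 : (P * T).trace = (Pᴴ * T * P).trace := by
    rw [hP]
    calc (P * T).trace = (T * P).trace := trace_mul_comm _ _
      _ = (T * (P * P)).trace := by rw [hPP]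
      _ = (T * P * P).trace := by rw [Matrix.mul_assoc]
      _ = (P * (T * P)).trace := trace_mul_comm _ _
      _ = (P * T * P).trace := by rw [Matrix.mul_assoc]
  have htr : (P * T).trace = ∑ σ, star (P.col σ) ⬝ᵥ T *ᵥ (P.col σ) := by
    rw [h1]
    simp only [Matrix.trace, Matrix.diag, Matrix.mul_apply, dotProduct, mulVec, Matrix.col_apply,
      Pi.star_apply, conjTranspose_apply, Finset.sum_mul, Finset.mul_sum]
    refine Finset.sum_congr rfl fun σ _ => ?_
    rw [Finset.sum_comm]
    refine Finset.sum_congr rfl fun a _ => Finset.sum_congr rfl fun b _ => ?_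
    ring
  have hcol : ∀ σ, P.col σ ∈ A.groundSpace := fun σ => by
    rw [← mulVec_single_one]
    exact groundProj_mulVec_mem A _
  have hre : 0 ≤ ((P * T).trace).re := by
    rw [htr, Complex.re_sum]
    exact Finset.sum_nonneg fun σ _ => hT _ (hcol σ)
  have hZ : 0 ≤ P.trace := (posSemidef_groundProj A).trace_nonneg
  obtain ⟨hZre, hZim⟩ := Complex.nonneg_iff.mp hZ
  rw [Complex.mul_re, Complex.inv_re, Complex.inv_im, ← hZim]
  simp only [neg_zero, zero_div, zero_mul, sub_zero]
  exact mul_nonneg (div_nonneg hZre (Complex.normSq_nonneg _)) hre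

variable {Λ : Type*} [Fintype Λ] [DecidableEq Λ]

/-- `star v ⬝ᵥ (Cᴴ C) v = ‖C v‖²`. [folklore] -/
theorem star_dotProduct_conjTranspose_mul_mulVec {m : Type*} [Fintype m] (C : Matrix m m ℂ)
    (v : m → ℂ) : star v ⬝ᵥ (Cᴴ * C) *ᵥ v = star (C *ᵥ v) ⬝ᵥ (C *ᵥ v) := by
  rw [← mulVec_mulVec, dotProduct_mulVec, ← star_mulVec]

/-- Entries of `S⁺_x w`: `(S⁺_x w)(σ) = [σ_x = ↑] · w(σ with x ↓)`. [folklore] -/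
theorem E_mulVec_apply (x : Λ) (w : TensorIndex Λ 2 → ℂ) (σ : TensorIndex Λ 2) :
    (E x *ᵥ w) σ = if σ x = 0 then w (Function.update σ x 1) else 0 := by
  rw [E, LiebMattis.onSite_mulVec_apply, Fin.sum_univ_two]
  have h0 : ∀ k : Fin 2, raise k 0 = 0 := by
    intro k; fin_cases k <;> simp [raise]
  have h1 : ∀ k : Fin 2, raise k 1 = if k = 0 then 1 else 0 := by
    intro k; fin_cases k <;> simp [raise]
  rw [h0, h1, zero_mul, zero_add]
  split_ifs <;> simp

/-- `(S⁺_x)² = 0` for spin ½. [folklore] -/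
theorem E_mul_E (x : Λ) : E x * E x = (0 : Op Λ 2) := by
  rw [E, onSite_mul]
  have : raise * raise = 0 := by
    ext i j; fin_cases i <;> fin_cases j <;> simp [raise, Matrix.mul_apply]
  rw [this]
  ext σ τ
  simp [onSite_apply]

/-- A vector killed by every `S⁺_y` is a multiple of the all-up vector. [folklore] -/
theorem eq_smul_upVec_of_forall_E_mulVec_eq_zero (w : TensorIndex Λ 2 → ℂ)
    (h : ∀ y : Λ, E y *ᵥ w = 0) : w = w (fun _ => 0) • upVec := by
  ext τ
  by_cases hτ : τ = fun _ => 0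
  · subst hτ
    simp [upVec]
  · obtain ⟨y, hy⟩ : ∃ y, τ y ≠ 0 := by
      by_contra hcon
      push Not at hcon
      exact hτ (funext hcon)
    have hy1 : τ y = 1 := by
      rcases Fin.exists_fin_two.mp ⟨τ y, rfl⟩ with h0 | h1
      · exact absurd h0 hy
      · exact h1
    have key := congrFun (h y) (Function.update τ y 0)
    rw [E_mulVec_apply, Pi.zero_apply, if_pos (Function.update_self _ _ _),
      Function.update_idem, ← hy1, Function.update_eq_self] at key
    rw [key, Pi.smul_apply, upVec, Pi.single_apply, if_neg hτ, smul_zero]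

/-- `e eᴴ − eᴴ e = σᶻ = 2S³` for spin ½. [folklore] -/
theorem raise_mul_conjTranspose_sub : raise * raiseᴴ - raiseᴴ * raise = (2 : ℂ) • spinVec 1 2 := by
  have hct : raiseᴴ = !![0, 0; 1, 0] := by
    ext i j; fin_cases i <;> fin_cases j <;> simp [raise, conjTranspose_apply]
  rw [hct, spinVec_one_eq_half_spinHalfPauli, smul_smul, spinHalfPauli_two_eq]
  ext i j
  fin_cases i <;> fin_cases j <;> norm_num [raise, pDown, Matrix.mul_apply, Fin.sum_univ_two]

/-- The commutator `S⁺_xS⁻_x − S⁻_xS⁺_x = 2S³_x`. [folklore] -/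
theorem E_mul_conjTranspose_sub (x : Λ) : E x * (E x)ᴴ - (E x)ᴴ * E x = (2 : ℂ) • siteSpin 1 x 2 := by
  rw [E_conjTranspose, E, onSite_mul, onSite_mul, ← onSite_sub', raise_mul_conjTranspose_sub,
    onSite_smul', siteSpin]

/-- **The order-parameter operator**: `Σ_{x,y}(S¹_xS¹_y + S²_xS²_y) = (S⁺_tot)ᴴ S⁺_tot + S³_tot`.
[folklore] -/
theorem sum_hop_eq :
    ∑ x : Λ, ∑ y : Λ, hop x y = (∑ x : Λ, E x)ᴴ * (∑ x : Λ, E x) + totalSpin 1 2 := by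
  have hcomm : ∀ x y : Λ, x ≠ y → E x * (E y)ᴴ = (E y)ᴴ * E x := fun x y hxy => by
    rw [E_conjTranspose, E, onSite_mul_onSite_comm hxy]
  have h1 : ∑ x : Λ, ∑ y : Λ, E x * (E y)ᴴ =
      ∑ x : Λ, ∑ y : Λ, (E y)ᴴ * E x + (2 : ℂ) • totalSpin 1 2 := by
    unfold totalSpin
    rw [Finset.smul_sum, ← Finset.sum_add_distrib]
    refine Finset.sum_congr rfl fun x _ => ?_
    rw [← E_mul_conjTranspose_sub, ← Finset.sum_erase_add _ _ (Finset.mem_univ x),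
      ← Finset.sum_erase_add (Finset.univ) (fun y => (E y)ᴴ * E x) (Finset.mem_univ x)]
    rw [add_assoc, add_sub_cancel, Finset.sum_congr rfl fun y hy => hcomm x y
      (Finset.ne_of_mem_erase hy).symm]
  have h2 : ∑ x : Λ, ∑ y : Λ, (E y)ᴴ * E x = (∑ x : Λ, E x)ᴴ * ∑ x : Λ, E x := by
    rw [Matrix.conjTranspose_sum, Finset.sum_mul_sum, Finset.sum_comm]
  calc ∑ x : Λ, ∑ y : Λ, hop x y
      = ∑ x : Λ, ∑ y : Λ, (1 / 2 : ℂ) • (E x * (E y)ᴴ + (E x)ᴴ * E y) :=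
        Finset.sum_congr rfl fun x _ => Finset.sum_congr rfl fun y _ => hop_eq x y
    _ = (1 / 2 : ℂ) • (∑ x : Λ, ∑ y : Λ, E x * (E y)ᴴ + ∑ x : Λ, ∑ y : Λ, (E x)ᴴ * E y) := by
        simp only [Finset.smul_sum, smul_add, Finset.sum_add_distrib]
    _ = (1 / 2 : ℂ) • ((∑ x : Λ, E x)ᴴ * (∑ x : Λ, E x) + (2 : ℂ) • totalSpin 1 2 +
          (∑ x : Λ, E x)ᴴ * ∑ x : Λ, E x) := by
        rw [h1, h2, Matrix.conjTranspose_sum, Finset.sum_mul_sum]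
    _ = (∑ x : Λ, E x)ᴴ * (∑ x : Λ, E x) + totalSpin 1 2 := by module

/-- `Re ⟨v, S³_tot v⟩ ≤ (|Λ|/2)‖v‖²` (`S³_tot = |Λ|/2 − N↓`, `N↓ = Σ (S⁺)ᴴS⁺ ≥ 0`). [folklore] -/
theorem re_totalSpin_two_quad_le (v : TensorIndex Λ 2 → ℂ) :
    (star v ⬝ᵥ (totalSpin 1 2 : Op Λ 2) *ᵥ v).re ≤
      (Fintype.card Λ : ℝ) / 2 * (star v ⬝ᵥ v).re := by
  rw [totalSpin_two_eq, sub_mulVec, smul_mulVec, one_mulVec, dotProduct_sub, dotProduct_smul,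
    Matrix.sum_mulVec, dotProduct_sum, Complex.sub_re, smul_eq_mul, Complex.re_sum]
  have hP : ∀ x : Λ, 0 ≤ (star v ⬝ᵥ Pd x *ᵥ v).re := fun x => by
    rw [← E_conjTranspose_mul_E, star_dotProduct_conjTranspose_mul_mulVec]
    exact (Complex.nonneg_iff.mp (dotProduct_star_self_nonneg _)).1
  have hsum : 0 ≤ ∑ x : Λ, (star v ⬝ᵥ Pd x *ᵥ v).re := Finset.sum_nonneg fun x _ => hP x
  have hcast : (((Fintype.card Λ : ℂ) / 2) * (star v ⬝ᵥ v)).re =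
      (Fintype.card Λ : ℝ) / 2 * (star v ⬝ᵥ v).re := by
    rw [show ((Fintype.card Λ : ℂ) / 2) = (((Fintype.card Λ : ℝ) / 2 : ℝ) : ℂ) by push_cast; ring,
      Complex.re_ofReal_mul]
  rw [hcast]
  linarith

end Boundary

end Summit.AtomisticToContinuum.BoseEinsteinCondensation.Theorems.LatticeODLROOffHalfFilling.Negative
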